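import Literature.NumberTheory.Automorphic.ConjSelfDualParityLEmbedding
import Literature.NumberTheory.Automorphic.AsaiSignArchParityRankOne
import Literature.NumberTheory.Automorphic.AsaiSignContRankOne
import HarnessLib

/-!
# Parity of conjugate self-dual archimedean parameters with general exponents, and the
parameter-level form of Mok's archimedean sign pin

Topic `NumberTheory/Automorphic`; namespace `Literature.NumberTheory.Automorphic`.  Theorem file
(definitions with bodies and proved theorems only, no named fact; provefact unit
`Mok2014_archimedean_parity_of_asaiSign`, 2026-08-16, session 7), continuing
`ConjSelfDualParityDiagonal` (Mok's (2.2.6), Remark 2.2.2 and the Example before Cor. 2.5.5 for the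
TEMPERED shape (2.5.12), `diag((z/|z|)^{m_i})`) and `ConjSelfDualParityLEmbedding` (Lemma 2.2.1).

## Why this file

The two named facts `Mok2014_archimedean_parity_of_asaiSign` (`AsaiSign.lean`) and
`Mok2014_archimedean_parity_of_asaiSignCont` (`AsaiSignCont.lean`) render Mok's Cor. 2.5.5 (C. P. Mok,
*Endoscopic classification of representations of quasi-split unitary groups*, Mem. AMS 235 (2015),
no. 1108) through the archimedean parameter `HasArchParameter χ` of the automorphic datum — i.e.
through the INFINITESIMAL CHARACTER of `Π_σ`: the multiset `χ σ = {a_i}` of `z`-exponents (and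
`χ σ̄ = {b_i}`), NOT the Langlands parameter `z ↦ ⊕_i z^{a_i} z̄^{b_i}` with its pairing `(a_i, b_i)`.
Mok's proof (Example before Cor. 2.5.5) runs on the Langlands parameter: by Thm. 2.4.10 and
Lemma 2.2.1 it is conjugate self-dual of parity `(-1)^{N-1} κ`, and for the tempered shape (2.5.12)
(`b_i = -a_i`, distinct `a_i`) the parity pins `(-1)^{2a_i}` (Remark 2.2.2, (2.2.6)).  For a GENERAL
parameter `⊕_i z^{a_i} z̄^{b_i}` conjugate self-duality only produces the involution `i ↦ i^*` with
`χ_{i^*} = (χ_i^c)^{-1}`, i.e. `(a_{i^*}, b_{i^*}) = (-b_i, -a_i)` (Mok §2.3, (2.3.4): `K = I ⊔ J ⊔ J^*`),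
and the parity constrains only the fixed points `i ∈ I`; a two-element orbit `{j, j^*}` ("hyperbolic
pair" `z^a z̄^b ⊕ z^{-b} z̄^{-a}`) is conjugate self-dual of BOTH parities (Remark 2.2.2: "its parity
need not be unique").  Such a pair with `z`-exponents `a, -b` distinct and in one coset `r + ℤ` would
violate the coset conclusion of the facts (e.g. `z ⊕ z̄^{-1}`: exponents `1, 0`); what excludes it for
`Π_σ` is the Jacquet–Shalika archimedean bound `|Re(a_i + b_i)| < 1` on the exponents of a unitary
generic representation (equivalently Tadić's classification), since `a_j - a_{j^*} = a_j + b_j ∈ ℤ`.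
This file proves the resulting LOCAL statement in full generality and reduces both named facts to
the corresponding PARAMETER-LEVEL archimedean statement (displayed as a hypothesis, not minted).

## What is proved

* §1 (any characters `χ_i : ℂˣ →* ℂ`): the conjugate-dual character `χ^*(z) = χ(z̄)⁻¹`
  (`conjDualChar`); if `diag(χ_i)` is conjugate self-dual of parity `η` (`IsConjSelfDualOfParity`,
  (2.2.6)) then every `χ_i` has a partner `χ_j = χ_i^*`
  (`exists_eq_conjDualChar_of_isConjSelfDualOfParity_diagParam` — the involution, read off the
  non-degeneracy of the form `A`); an ISOLATED fixed point (`χ_j = χ_i^* ⇒ j = i`) carries the sign,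
  `χ_i(-1) = η` (`apply_neg_one_eq_of_isConjSelfDualOfParity_diagParam_of_isolated`, generalising
  `apply_neg_one_eq_of_isConjSelfDualOfParity_diagParam` of `ConjSelfDualParityDiagonal`, which assumed
  all `χ_i` conjugate-inverse); and sharpness: `diag(χ, χ^*)` has both parities
  (`isConjSelfDualOfParity_diagParam_pair`).
* §2: the archimedean quasi-characters `archParamChar t m : z ↦ |z|^t (z/|z|)^m` (`= z^a z̄^b`,
  `t = a + b`, `m = a - b ∈ ℤ`, the character encoded by an `ArchWeight (a, b)`): conjugate
  `archParamChar t (-m)`, conjugate-dual `archParamChar (-t) m`, value `(-1)^m` at `-1`, value `e^{ut}` at `e^u`,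
  and injectivity of `(t, m) ↦ archParamChar t m`.
* §3 (main local lemma, `eq_zero_and_neg_one_zpow_eq_of_isConjSelfDualOfParity_archDiagParam`): if
  `diag(archParamChar t_i m_i)` is conjugate self-dual of parity `η`, the `z`-exponents `a_i = (t_i + m_i)/2`
  are pairwise distinct and lie in one coset of `ℤ`, and `|Re t_i| < 1` for all `i`, then every
  `t_i = 0` (the parameter is tempered, of shape (2.5.12)) and `(-1)^{m_i} = η`; coset form
  `exists_half_eq_of_isConjSelfDualOfParity_archDiagParam` and the multiset form
  `forall_mem_exists_eq_add_coset_of_archParameter`, whose conclusion is literally that of the facts.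
* §4: `Mok2014_archimedean_parity_of_asaiSignCont_of_archParameter` and
  `Mok2014_archimedean_parity_of_asaiSign_of_archParameter`: both named facts follow (the raw one also
  using `Mok2014_partialAsaiL_continuation_pole_dichotomy`, and both using the proved rank-one
  stratum) from the parameter-level archimedean statement for `N ≥ 2` — Mok's Thm. 2.4.10 with
  Thm. 2.5.4 (a) and Lemma 2.2.1 at a real place of `F` under a complex place of `E`, transported to
  the `z`-exponents by the local Langlands correspondence for `GL_N(ℂ)` (compatibility with
  infinitesimal characters) and supplemented by the Jacquet–Shalika archimedean bound — displayed
  verbatim as the hypothesis `hparam`.  That statement is not expressible as a faithful named fact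
  of the tree today (the automorphic data carry no pairing-level archimedean parameter), so it is
  NOT introduced as a definition here.

## References

* C. P. Mok, *Endoscopic classification of representations of quasi-split unitary groups*,
  Mem. Amer. Math. Soc. 235 (2015), no. 1108 (arXiv:1206.0882): §2.2 (2.2.3)–(2.2.6), Lemma 2.2.1,
  Remark 2.2.2 (arXiv pp. 8–9); §2.3 (2.3.4)–(2.3.5) (p. 11); Thm. 2.4.2, Thm. 2.4.10 (pp. 13, 16);
  Thm. 2.5.4 (a), Example and Cor. 2.5.5 with (2.5.12) (pp. 20–21). [Mok2014]
* Z. Rudnick, P. Sarnak, *Zeros of principal `L`-functions and random matrix theory*, Duke Math. J.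
  81 (1996), (2.5) and Appendix A.3: for the archimedean component `π_∞` of a cuspidal automorphic
  representation, written as a Langlands quotient with exponents `t_j = Re s_j`, `2 max |t_j| < 1`
  (from the Rankin–Selberg theory of Jacquet–Shalika and Mœglin–Waldspurger; a local proof goes
  through the classification of the generic unitary dual).  In the exponent notation `z^a z̄^b`
  (`|z^a z̄^b| = |z|_ℂ^{Re(a+b)/2}`) this is the hypothesis `|Re(a_i + b_i)| < 1` below; the
  finite-place analogue is Jacquet–Shalika 1981, (2.5)/Cor. 2.5. [RudnickSarnakDuke1996]
  [JacquetShalikaAJM1981]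
* W. T. Gan, B. H. Gross, D. Prasad, *Symplectic local root numbers, central critical `L`-values, and
  restriction problems in the representation theory of classical groups*, Astérisque 346 (2012), §3.
  [GanGrossPrasad2012]
-/

noncomputable section

open scoped ComplexConjugate Matrix NumberField
open Complex

namespace Literature.NumberTheory.Automorphic

/-! ## §1 General diagonal parameters: the involution `χ ↦ χ^*` and the sign of isolated fixed points -/

section General

variable {ι : Type*} [Fintype ι] [DecidableEq ι]

/-- A character of `W_ℂ = ℂˣ` never vanishes (`χ(z) χ(z⁻¹) = 1`). [folklore] -/
theorem unitsChar_apply_ne_zero (χ : ℂˣ →* ℂ) (z : ℂˣ) : χ z ≠ 0 := by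
  intro h
  have h1 : χ z * χ z⁻¹ = 1 := by rw [← map_mul, mul_inv_cancel, map_one]
  rw [h, zero_mul] at h1
  exact zero_ne_one h1

/-- **The conjugate-dual character** `χ^* := (χ^c)^∨ : z ↦ χ(z̄)⁻¹` of a character `χ` of
`W_ℂ = ℂˣ` — the one-dimensional case of `ρ ↦ (ρ^c)^∨` (Mok, (2.2.3); the involution `ψ ↦ ψ^*`
of §2.3). [cite: Mok2014, (2.2.3) and §2.3] -/
def conjDualChar (χ : ℂˣ →* ℂ) : ℂˣ →* ℂ where
  toFun z := (χ (weilConj z))⁻¹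
  map_one' := by rw [map_one, map_one, inv_one]
  map_mul' z w := by rw [map_mul, map_mul, mul_inv]

/-- Unfolding `conjDualChar`. [cite: Mok2014, (2.2.3)] -/
@[simp]
theorem conjDualChar_apply (χ : ℂˣ →* ℂ) (z : ℂˣ) : conjDualChar χ z = (χ (weilConj z))⁻¹ :=
  rfl

/-- `χ ↦ χ^*` is an involution. [cite: Mok2014, §2.3] -/
theorem conjDualChar_conjDualChar (χ : ℂˣ →* ℂ) : conjDualChar (conjDualChar χ) = χ := by
  ext z
  simp [weilConj_weilConj]

/-- `χ^* = χ` iff `χ` is conjugate-inverse, `χ(z̄) χ(z) = 1` (a conjugate self-dual one-dimensional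
parameter). [cite: Mok2014, §2.2] -/
theorem conjDualChar_eq_self_iff (χ : ℂˣ →* ℂ) :
    conjDualChar χ = χ ↔ ∀ z, χ (weilConj z) * χ z = 1 := by
  constructor
  · intro h z
    have hz := DFunLike.congr_fun h z
    rw [conjDualChar_apply] at hz
    rw [← hz, mul_inv_cancel₀ (unitsChar_apply_ne_zero χ _)]
  · intro h
    ext z
    rw [conjDualChar_apply]
    exact (eq_inv_of_mul_eq_one_right (h z)).symm

/-- **Reading the invariance (2.2.4) entrywise.**  If `ᵗρ^c(z) A ρ(z) = A` for the diagonal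
parameter `ρ = diag(χ_i)` and `A_{ij} ≠ 0`, then `χ_j = χ_i^*`: the `(i, j)` entry reads
`χ_i(z̄) A_{ij} χ_j(z) = A_{ij}`. [cite: Mok2014, (2.2.4)–(2.2.6)] -/
theorem eq_conjDualChar_of_entry_ne_zero {χ : ι → (ℂˣ →* ℂ)} {A : Matrix ι ι ℂ}
    (hinv : ∀ z : ℂˣ, (diagParam χ (weilConj z))ᵀ * A * diagParam χ z = A) {i j : ι}
    (hij : A i j ≠ 0) : χ j = conjDualChar (χ i) := by
  ext z
  have h1 := congrFun (congrFun (hinv z) i) j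
  simp only [diagParam_apply, Matrix.diagonal_transpose, Matrix.mul_diagonal,
    Matrix.diagonal_mul] at h1
  -- `h1 : χ i (weilConj z) * A i j * χ j z = A i j`
  have h2 : A i j * (χ i (weilConj z) * χ j z - 1) = 0 := by linear_combination h1
  have h3 : χ i (weilConj z) * χ j z = 1 := sub_eq_zero.mp ((mul_eq_zero.mp h2).resolve_left hij)
  rw [conjDualChar_apply]
  exact eq_inv_of_mul_eq_one_right h3

/-- **The involution of a conjugate self-dual diagonal parameter** (Mok §2.3 (2.3.4), local and
semisimple case; Remark 2.2.2): if `diag(χ_i)` is conjugate self-dual (of some parity `η`), then every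
constituent `χ_i` has a conjugate-dual partner among the constituents, `χ_j = χ_i^*` — the row `i` of
the non-degenerate form `A` has a non-zero entry. [cite: Mok2014, §2.3 (2.3.4) and Remark 2.2.2] -/
theorem exists_eq_conjDualChar_of_isConjSelfDualOfParity_diagParam {χ : ι → (ℂˣ →* ℂ)} {η : ℤˣ}
    (h : IsConjSelfDualOfParity (diagParam χ) η) (i : ι) : ∃ j, χ j = conjDualChar (χ i) := by
  obtain ⟨A, hA, hinv, -⟩ := h
  by_contra hne
  refine hA.ne_zero (Matrix.det_eq_zero_of_row_eq_zero i fun j => ?_)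
  by_contra hij
  exact hne ⟨j, eq_conjDualChar_of_entry_ne_zero hinv hij⟩

/-- **An isolated fixed point of the involution carries the parity** (Mok, Remark 2.2.2 with (2.2.6)):
if `diag(χ_i)` is conjugate self-dual of parity `η` and the only constituent equal to `χ_i^*` is (at
most) `χ_i` itself, then `χ_i(w_c²) = χ_i(-1) = η`.  Proof: row `i` of `A` is `A_{ii} e_i` with
`A_{ii} ≠ 0`, and the `(i, i)` entry of `ᵗA = η A ρ(-1)` reads `A_{ii} = η A_{ii} χ_i(-1)`.
[cite: Mok2014, Remark 2.2.2 and (2.2.6)] -/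
theorem apply_neg_one_eq_of_isConjSelfDualOfParity_diagParam_of_isolated {χ : ι → (ℂˣ →* ℂ)}
    {η : ℤˣ} (h : IsConjSelfDualOfParity (diagParam χ) η) {i : ι}
    (hi : ∀ j, χ j = conjDualChar (χ i) → j = i) : χ i (-1) = ((η : ℤ) : ℂ) := by
  obtain ⟨A, hA, hinv, hsign⟩ := h
  have hoff : ∀ j, j ≠ i → A i j = 0 := by
    intro j hji
    by_contra hij
    exact hji (hi j (eq_conjDualChar_of_entry_ne_zero hinv hij))
  have hii : A i i ≠ 0 := by
    intro h0
    refine hA.ne_zero (Matrix.det_eq_zero_of_row_eq_zero i fun j => ?_)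
    by_cases hji : j = i
    · rw [hji, h0]
    · exact hoff j hji
  have h3 := congrFun (congrFun hsign i) i
  simp only [Matrix.transpose_apply, diagParam_apply, Matrix.smul_apply, Matrix.mul_diagonal,
    smul_eq_mul] at h3
  -- `h3 : A i i = η * (A i i * χ i (-1))`
  have h4 : A i i * (((η : ℤ) : ℂ) * χ i (-1) - 1) = 0 := by linear_combination -h3
  have h5 : ((η : ℤ) : ℂ) * χ i (-1) = 1 := sub_eq_zero.mp ((mul_eq_zero.mp h4).resolve_left hii)
  linear_combination ((η : ℤ) : ℂ) * h5 - χ i (-1) * intUnits_cast_complex_mul_self η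

/-- The same for pairwise distinct constituents: a fixed point `χ_i^* = χ_i` of the involution has
`χ_i(-1) = η` (Mok, Remark 2.2.2: mutually non-isomorphic conjugate self-dual constituents).
[cite: Mok2014, Remark 2.2.2] -/
theorem apply_neg_one_eq_of_isConjSelfDualOfParity_diagParam_of_injective {χ : ι → (ℂˣ →* ℂ)}
    (hχ : Function.Injective χ) {η : ℤˣ} (h : IsConjSelfDualOfParity (diagParam χ) η) {i : ι}
    (hfix : conjDualChar (χ i) = χ i) : χ i (-1) = ((η : ℤ) : ℂ) :=
  apply_neg_one_eq_of_isConjSelfDualOfParity_diagParam_of_isolated h fun _ hj =>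
    hχ (hj.trans hfix)

/-- `χ(-1) = ±1`, i.e. `χ(-1) χ(-1) = 1`, for a character of `ℂˣ`. [folklore] -/
theorem unitsChar_neg_one_mul_self (χ : ℂˣ →* ℂ) : χ (-1) * χ (-1) = 1 := by
  rw [← map_mul, neg_mul_neg, one_mul, map_one]

/-- `χ^*(-1) = χ(-1)`. [folklore] -/
theorem conjDualChar_neg_one (χ : ℂˣ →* ℂ) : conjDualChar χ (-1) = χ (-1) := by
  rw [conjDualChar_apply, weilConj_neg_one]
  exact inv_eq_of_mul_eq_one_right (unitsChar_neg_one_mul_self χ)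

/-- **Sharpness: a hyperbolic pair has both parities** (Mok, Remark 2.2.2, "its parity need not be
unique"; the two-element orbits `{j, j^*}` of §2.3 (2.3.4)).  For ANY character `χ` of `W_ℂ` and any
sign `η`, the parameter `diag(χ, χ^*)` is conjugate self-dual of parity `η`: take
`A = ( 0 1 ; η χ(-1) 0 )`. [cite: Mok2014, Remark 2.2.2 and §2.3 (2.3.4)] -/
theorem isConjSelfDualOfParity_diagParam_pair (χ : ℂˣ →* ℂ) (η : ℤˣ) :
    IsConjSelfDualOfParity (diagParam ![χ, conjDualChar χ]) η := by
  have hs := unitsChar_neg_one_mul_self χ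
  have hη := intUnits_cast_complex_mul_self η
  have hs0 : χ (-1) ≠ 0 := unitsChar_apply_ne_zero χ _
  have hη0 : ((η : ℤ) : ℂ) ≠ 0 := fun h0 => by rw [h0, zero_mul] at hη; exact zero_ne_one hη
  refine ⟨!![0, 1; ((η : ℤ) : ℂ) * χ (-1), 0], ?_, fun z => ?_, ?_⟩
  · rw [Matrix.det_fin_two_of]
    simp only [zero_mul, one_mul, zero_sub, isUnit_iff_ne_zero, ne_eq, neg_eq_zero, mul_eq_zero,
      hη0, hs0, or_self, not_false_eq_true]
  · have hz : χ (weilConj z) ≠ 0 := unitsChar_apply_ne_zero χ _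
    have hz' : χ z ≠ 0 := unitsChar_apply_ne_zero χ _
    ext i j
    simp only [diagParam_apply, Matrix.diagonal_transpose, Matrix.mul_diagonal, Matrix.diagonal_mul]
    fin_cases i <;> fin_cases j
    · simp
    · simp [hz]
    · -- the `(1, 0)` entry: `χ(z)⁻¹ (η χ(-1)) χ(z) = η χ(-1)`
      simp [weilConj_weilConj]
      linear_combination (((η : ℤ) : ℂ) * χ (-1)) * inv_mul_cancel₀ hz'
    · simp
  · ext i j
    simp only [Matrix.transpose_apply, Matrix.smul_apply, diagParam_apply, Matrix.mul_diagonal,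
      smul_eq_mul]
    fin_cases i <;> fin_cases j
    · simp
    · simp
      exact eq_inv_of_mul_eq_one_right hs
    · -- the `(1, 0)` entry: `1 = η (η χ(-1) χ(-1))`
      simp
      linear_combination -(χ (-1) * χ (-1)) * hη - hs
    · simp

end General

/-! ## §2 The archimedean quasi-characters `z ↦ |z|^t (z/|z|)^m = z^a z̄^b` -/

section ArchChar

/-- **The archimedean quasi-character** `archParamChar t m : z ↦ |z|^t · (z/|z|)^m` of `W_ℂ = ℂˣ`
(`t ∈ ℂ`, `m ∈ ℤ`; `|z|^t := exp(t log |z|)`).  In the exponent notation of Clozel / Buzzard–Gee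
(`ArchWeight`) and of Mok's (2.5.12) this is `z ↦ z^a z̄^b` with `a = (t + m)/2`, `b = (t - m)/2`
(`a - b = m ∈ ℤ`, `a + b = t`); every character of `ℂˣ` is of this form.  The tempered characters
are those with `Re t = 0`, the shape (2.5.12) is `t = 0` (`archParamChar 0 m = unitArgChar m`).
[cite: Mok2014, (2.5.12)] [cite: BuzzardGee2014, §3.1] -/
def archParamChar (t : ℂ) (m : ℤ) : ℂˣ →* ℂ where
  toFun z := ((‖(z : ℂ)‖ : ℂ) ^ t) * (((z : ℂ) / ‖(z : ℂ)‖) ^ m)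
  map_one' := by simp
  map_mul' z w := by
    simp only [Units.val_mul, norm_mul, Complex.ofReal_mul]
    rw [Complex.mul_cpow_ofReal_nonneg (norm_nonneg _) (norm_nonneg _), mul_div_mul_comm, mul_zpow]
    ring

/-- Unfolding `archParamChar`. [cite: Mok2014, (2.5.12)] -/
theorem archParamChar_apply (t : ℂ) (m : ℤ) (z : ℂˣ) :
    archParamChar t m z = ((‖(z : ℂ)‖ : ℂ) ^ t) * (((z : ℂ) / ‖(z : ℂ)‖) ^ m) :=
  rfl

/-- `archParamChar t m = |·|^t · unitArgChar m`. [cite: Mok2014, (2.5.12)] -/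
theorem archParamChar_eq_mul_unitArgChar (t : ℂ) (m : ℤ) (z : ℂˣ) :
    archParamChar t m z = ((‖(z : ℂ)‖ : ℂ) ^ t) * unitArgChar m z :=
  rfl

/-- The factor `|z|^t` does not vanish. [folklore] -/
theorem archParamChar_normFactor_ne_zero (t : ℂ) (z : ℂˣ) : ((‖(z : ℂ)‖ : ℂ) ^ t) ≠ 0 :=
  Complex.cpow_ne_zero_iff.mpr (Or.inl (by exact_mod_cast norm_ne_zero_iff.mpr z.ne_zero))

/-- **The shape (2.5.12) is `t = 0`**: `archParamChar 0 m = (z/|z|)^m = unitArgChar m`.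
[cite: Mok2014, (2.5.12)] -/
theorem archParamChar_zero (m : ℤ) : archParamChar 0 m = unitArgChar m := by
  ext z
  rw [archParamChar_eq_mul_unitArgChar, Complex.cpow_zero, one_mul]

/-- `unitArgChar (-m) = (unitArgChar m)⁻¹` pointwise. [folklore] -/
theorem unitArgChar_neg (m : ℤ) (z : ℂˣ) : unitArgChar (-m) z = (unitArgChar m z)⁻¹ := by
  rw [unitArgChar_apply, unitArgChar_apply, zpow_neg]

/-- **Conjugation**: `archParamChar t m (z̄) = archParamChar t (-m) (z)` (`|z̄| = |z|`, `z̄/|z̄| = (z/|z|)⁻¹`),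
i.e. `(z^a z̄^b)^c = z^b z̄^a`. [cite: Mok2014, (2.2.3)] -/
theorem archParamChar_weilConj (t : ℂ) (m : ℤ) (z : ℂˣ) :
    archParamChar t m (weilConj z) = archParamChar t (-m) z := by
  rw [archParamChar_eq_mul_unitArgChar, archParamChar_eq_mul_unitArgChar, unitArgChar_weilConj,
    unitArgChar_neg, coe_weilConj, Complex.norm_conj]

/-- **Conjugate dual**: `(archParamChar t m)^* = archParamChar (-t) m`, i.e. `(z^a z̄^b)^* = z^{-b} z̄^{-a}`.
[cite: Mok2014, (2.2.3) and §2.3] -/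
theorem conjDualChar_archParamChar (t : ℂ) (m : ℤ) : conjDualChar (archParamChar t m) = archParamChar (-t) m := by
  ext z
  rw [conjDualChar_apply, archParamChar_weilConj, archParamChar_eq_mul_unitArgChar,
    archParamChar_eq_mul_unitArgChar, mul_inv, unitArgChar_neg, inv_inv, Complex.cpow_neg]

/-- The positive real `e^u` as an element of `W_ℂ = ℂˣ`. [folklore] -/
def expUnit (u : ℝ) : ℂˣ :=
  Units.mk0 ((Real.exp u : ℝ) : ℂ) (by exact_mod_cast (Real.exp_pos u).ne')

/-- Unfolding `expUnit`. [folklore] -/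
@[simp]
theorem coe_expUnit (u : ℝ) : ((expUnit u : ℂˣ) : ℂ) = ((Real.exp u : ℝ) : ℂ) :=
  rfl

/-- **Values on the positive reals**: `archParamChar t m (e^u) = e^{u t}`. [folklore] -/
theorem archParamChar_expUnit (t : ℂ) (m : ℤ) (u : ℝ) :
    archParamChar t m (expUnit u) = Complex.exp ((u : ℂ) * t) := by
  have hpos : 0 < Real.exp u := Real.exp_pos u
  have hne : ((Real.exp u : ℝ) : ℂ) ≠ 0 := by exact_mod_cast hpos.ne'
  rw [archParamChar_apply, coe_expUnit, Complex.norm_real, Real.norm_eq_abs, abs_of_pos hpos,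
    div_self hne, one_zpow, mul_one, Complex.cpow_def_of_ne_zero hne,
    ← Complex.ofReal_log hpos.le, Real.log_exp]

/-- **Injectivity of `(t, m) ↦ archParamChar t m`**: compare on the positive reals (`e^{ut} = e^{ut'}` for
all `u` forces `t = t'`, `eq_zero_of_forall_exp_ofReal_mul_eq_one` of `AsaiSignContRankOne`) and then
on the circle (`u^m = u^{m'}` forces `m = m'`,
`exists_unitArgChar_apply_ne`). [folklore] -/
theorem archParamChar_eq_archParamChar_iff {t t' : ℂ} {m m' : ℤ} :
    archParamChar t m = archParamChar t' m' ↔ t = t' ∧ m = m' := by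
  refine ⟨fun h => ?_, by rintro ⟨rfl, rfl⟩; rfl⟩
  have ht : t = t' := by
    have h1 : ∀ u : ℝ, Complex.exp ((u : ℂ) * (t - t')) = 1 := fun u => by
      have h2 := DFunLike.congr_fun h (expUnit u)
      rw [archParamChar_expUnit, archParamChar_expUnit] at h2
      rw [mul_sub, Complex.exp_sub, h2, div_self (Complex.exp_ne_zero _)]
    exact sub_eq_zero.mp (eq_zero_of_forall_exp_ofReal_mul_eq_one h1)
  subst ht
  refine ⟨rfl, ?_⟩
  by_contra hm
  obtain ⟨z, hz⟩ := exists_unitArgChar_apply_ne hm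
  refine hz ?_
  have h3 := DFunLike.congr_fun h z
  rw [archParamChar_eq_mul_unitArgChar, archParamChar_eq_mul_unitArgChar] at h3
  exact mul_left_cancel₀ (archParamChar_normFactor_ne_zero t z) h3

/-- `archParamChar t m` is conjugate-inverse — a fixed point of `χ ↦ χ^*`, i.e. a conjugate self-dual
one-dimensional parameter — iff `t = 0` (iff it is of the shape (2.5.12)). [cite: Mok2014, (2.5.12)] -/
theorem conjDualChar_archParamChar_eq_self_iff (t : ℂ) (m : ℤ) :
    conjDualChar (archParamChar t m) = archParamChar t m ↔ t = 0 := by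
  rw [conjDualChar_archParamChar, archParamChar_eq_archParamChar_iff, neg_eq_iff_add_eq_zero, and_iff_left rfl]
  constructor
  · intro h; linear_combination h / 2
  · rintro rfl; simp

/-- **The value at `w_c² = -1`**: `archParamChar t m (-1) = (-1)^m`, i.e. `(z^a z̄^b)(-1) = (-1)^{a-b}`.
[cite: Mok2014, Example before Cor. 2.5.5] -/
theorem archParamChar_neg_one (t : ℂ) (m : ℤ) : archParamChar t m (-1) = (-1) ^ m := by
  rw [archParamChar_eq_mul_unitArgChar, unitArgChar_neg_one]
  simp

/-- **The character of an archimedean weight** `p = (a, b)` (`ArchWeight`, `a - b ∈ ℤ`, the entries of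
an `InfinityType`): `z ↦ z^a z̄^b = |z|^{a+b} (z/|z|)^{a-b}`, i.e. `archParamChar (a + b) (a - b)`.
[cite: BuzzardGee2014, §3.1] -/
def ArchWeight.char (p : ArchWeight) : ℂˣ →* ℂ :=
  archParamChar (p.a + p.b) p.exists_int_sub.choose

/-- `ArchWeight.char (a, b) = archParamChar (a + b) m` for the integer `m = a - b`. [cite: BuzzardGee2014, §3.1] -/
theorem ArchWeight.char_eq (p : ArchWeight) {m : ℤ} (hm : p.a - p.b = m) :
    p.char = archParamChar (p.a + p.b) m := by
  have h : (p.exists_int_sub.choose : ℂ) = m := p.exists_int_sub.choose_spec.symm.trans hm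
  rw [ArchWeight.char, show p.exists_int_sub.choose = m by exact_mod_cast h]

/-- The `z`-exponent `(t + m)/2` of `ArchWeight.char (a, b) = archParamChar t m` is `a`.
[cite: BuzzardGee2014, §3.1] -/
theorem ArchWeight.zExponent_char (p : ArchWeight) :
    (p.a + p.b + (p.exists_int_sub.choose : ℂ)) / 2 = p.a := by
  rw [← p.exists_int_sub.choose_spec]
  ring

end ArchChar

/-! ## §3 The main local lemma: parity + multiplicity one + one coset + the Jacquet–Shalika bound
force the tempered shape (2.5.12) and pin the exponents -/

section Main

variable {ι : Type*} [Fintype ι] [DecidableEq ι]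

/-- **Main local lemma.**  Let `ρ = diag(archParamChar t_i m_i) = ⊕_i z^{a_i} z̄^{b_i}`
(`a_i = (t_i + m_i)/2`, `b_i = (t_i - m_i)/2`) be conjugate self-dual of parity `η` ((2.2.6)).  Assume
(i) the `z`-exponents `a_i` are pairwise distinct (multiplicity one of the infinitesimal character),
(ii) they lie in one coset of `ℤ` (`a_i - a_j ∈ ℤ`), and (iii) `|Re t_i| = |Re(a_i + b_i)| < 1` for all
`i` (the Jacquet–Shalika / Rudnick–Sarnak bound `2 max|t_j| < 1` for the archimedean component of a
unitary cuspidal representation).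
Then every `t_i = 0` — `ρ` is the tempered parameter `diag((z/|z|)^{m_i})` of shape (2.5.12) — and
`(-1)^{m_i} = η` for every `i`.  Proof: the partner `j = i^*` of `i`
(`exists_eq_conjDualChar_of_isConjSelfDualOfParity_diagParam`) has `(t_j, m_j) = (-t_i, m_i)`, so
`a_i - a_j = t_i ∈ ℤ ∩ {|Re| < 1} = {0}`; hence `a_j = a_i`, `j = i` is an isolated fixed point, and
`apply_neg_one_eq_of_isConjSelfDualOfParity_diagParam_of_isolated` with `archParamChar_neg_one` gives the
sign. [cite: Mok2014, Remark 2.2.2, (2.2.6) and Example before Cor. 2.5.5]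
[cite: RudnickSarnakDuke1996, (2.5) and Appendix A.3] -/
theorem eq_zero_and_neg_one_zpow_eq_of_isConjSelfDualOfParity_archDiagParam {t : ι → ℂ} {m : ι → ℤ}
    {η : ℤˣ} (hinj : Function.Injective fun i => (t i + (m i : ℂ)) / 2)
    (hcoset : ∀ i j, ∃ k : ℤ, (t i + (m i : ℂ)) / 2 - (t j + (m j : ℂ)) / 2 = (k : ℂ))
    (hJS : ∀ i, |(t i).re| < 1)
    (h : IsConjSelfDualOfParity (diagParam fun i => archParamChar (t i) (m i)) η) (i : ι) :
    t i = 0 ∧ (-1 : ℂ) ^ (m i) = ((η : ℤ) : ℂ) := by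
  -- the only possible partner of `i` is `i` itself, and then `t i = 0`
  have key : ∀ j, archParamChar (t j) (m j) = conjDualChar (archParamChar (t i) (m i)) → t i = 0 ∧ j = i := by
    intro j hj
    rw [conjDualChar_archParamChar, archParamChar_eq_archParamChar_iff] at hj
    obtain ⟨htj, hmj⟩ := hj
    obtain ⟨k, hk⟩ := hcoset i j
    rw [htj, hmj] at hk
    have htk : t i = k := by linear_combination hk
    have hk1 : |k| < 1 := by
      have h1 := hJS i
      rw [htk, Complex.intCast_re] at h1
      exact_mod_cast h1
    have ht0 : t i = 0 := by rw [htk, Int.abs_lt_one_iff.mp hk1, Int.cast_zero]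
    refine ⟨ht0, hinj ?_⟩
    change (t j + (m j : ℂ)) / 2 = (t i + (m i : ℂ)) / 2
    rw [htj, hmj, ht0, neg_zero]
  obtain ⟨j, hj⟩ := exists_eq_conjDualChar_of_isConjSelfDualOfParity_diagParam h i
  refine ⟨(key j hj).1, ?_⟩
  rw [← archParamChar_neg_one (t i) (m i)]
  exact apply_neg_one_eq_of_isConjSelfDualOfParity_diagParam_of_isolated h fun j hj => (key j hj).2

/-- **Coset form** (the shape of the conclusion of `Mok2014_archimedean_parity_of_asaiSign`): under the
hypotheses of the main local lemma with `η = (-1)^{N-1} κ` (spelled `(-1)^{N+1} κ`), every `t_i = 0`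
(so `b_i = -a_i`) and every `a_i = m_i/2` lies in `(N-1)/2 + (1-κ)/4 + ℤ`.
[cite: Mok2014, Cor. 2.5.5 and Example before it] -/
theorem exists_half_eq_of_isConjSelfDualOfParity_archDiagParam {N : ℕ} {t : Fin N → ℂ}
    {m : Fin N → ℤ} {κ : ℤˣ} (hinj : Function.Injective fun i => (t i + (m i : ℂ)) / 2)
    (hcoset : ∀ i j, ∃ k : ℤ, (t i + (m i : ℂ)) / 2 - (t j + (m j : ℂ)) / 2 = (k : ℂ))
    (hJS : ∀ i, |(t i).re| < 1)
    (h : IsConjSelfDualOfParity (diagParam fun i => archParamChar (t i) (m i)) ((-1) ^ (N + 1) * κ))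
    (i : Fin N) :
    t i = 0 ∧ ∃ k : ℤ, (m i : ℂ) / 2 = (k : ℂ) + ((N : ℂ) - 1) / 2 + (1 - ((κ : ℤ) : ℂ)) / 4 := by
  obtain ⟨ht, hm⟩ := eq_zero_and_neg_one_zpow_eq_of_isConjSelfDualOfParity_archDiagParam hinj hcoset
    hJS h i
  refine ⟨ht, ?_⟩
  rw [← neg_one_zpow_eq_iff_exists_half_eq, ← intUnits_cast_neg_one_pow_mul]
  exact hm

/-- **Multiset form, literally the conclusion of the named facts.**  If a multiset `X` of complex
numbers (the archimedean parameter `χ σ` of the facts) is multiplicity free, lies in one real coset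
`r + ℤ`, and is the multiset of `z`-exponents `(t_i + m_i)/2` of a diagonal archimedean parameter
`diag(archParamChar t_i m_i)` which is conjugate self-dual of parity `(-1)^{N-1} κ` and satisfies the
Jacquet–Shalika bound `|Re t_i| < 1`, then every element of `X` lies in `(N-1)/2 + (1-κ)/4 + ℤ`.
[cite: Mok2014, Cor. 2.5.5] [cite: RudnickSarnakDuke1996, (2.5) and Appendix A.3] -/
theorem forall_mem_exists_eq_add_coset_of_archParameter {N : ℕ} {κ : ℤˣ} {X : Multiset ℂ} {r : ℝ}
    (hnodup : X.Nodup) (hcoset : ∀ a ∈ X, ∃ m : ℤ, a = (m : ℂ) + (r : ℂ))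
    {t : Fin N → ℂ} {m : Fin N → ℤ}
    (hX : X = Finset.univ.val.map fun i => (t i + (m i : ℂ)) / 2) (hJS : ∀ i, |(t i).re| < 1)
    (h : IsConjSelfDualOfParity (diagParam fun i => archParamChar (t i) (m i)) ((-1) ^ (N + 1) * κ)) :
    ∀ a ∈ X, ∃ k : ℤ, a = (k : ℂ) + ((N : ℂ) - 1) / 2 + (1 - ((κ : ℤ) : ℂ)) / 4 := by
  subst hX
  have hmem : ∀ i : Fin N, (t i + (m i : ℂ)) / 2 ∈
      Finset.univ.val.map fun i => (t i + (m i : ℂ)) / 2 :=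
    fun i => Multiset.mem_map_of_mem _ (Finset.mem_val.mpr (Finset.mem_univ i))
  have hinj : Function.Injective fun i => (t i + (m i : ℂ)) / 2 := fun i j hij =>
    Multiset.inj_on_of_nodup_map hnodup i (Finset.mem_val.mpr (Finset.mem_univ i)) j
      (Finset.mem_val.mpr (Finset.mem_univ j)) hij
  have hcoset' : ∀ i j, ∃ k : ℤ, (t i + (m i : ℂ)) / 2 - (t j + (m j : ℂ)) / 2 = (k : ℂ) := by
    intro i j
    obtain ⟨k, hk⟩ := hcoset _ (hmem i)
    obtain ⟨l, hl⟩ := hcoset _ (hmem j)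
    exact ⟨k - l, by rw [hk, hl]; push_cast; ring⟩
  intro a ha
  obtain ⟨i, -, rfl⟩ := Multiset.mem_map.mp ha
  obtain ⟨ht, k, hk⟩ := exists_half_eq_of_isConjSelfDualOfParity_archDiagParam hinj hcoset' hJS h i
  refine ⟨k, ?_⟩
  rw [ht, zero_add]
  exact hk

/-- **Consistency check (the tempered shape satisfies all hypotheses but multiplicity/coset, which are
about the exponents): `diag(archParamChar 0 m_i) = diag((z/|z|)^{m_i})` with `(-1)^{m_i} = ε` is conjugate
self-dual of parity `ε`** (Mok's Example with `A = I`, transported along `archParamChar_zero`).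
[cite: Mok2014, Example before Cor. 2.5.5] -/
theorem isConjSelfDualOfParity_archDiagParam_zero {m : ι → ℤ} {ε : ℤˣ}
    (hε : ∀ i, (-1 : ℂ) ^ (m i) = ((ε : ℤ) : ℂ)) :
    IsConjSelfDualOfParity (diagParam fun i => archParamChar 0 (m i)) ε := by
  have e : (fun i => archParamChar 0 (m i)) = fun i => unitArgChar (m i) := funext fun i => archParamChar_zero _
  rw [e]
  exact isConjSelfDualOfParity_unitaryDiagParam hε

/-- **Sharpness of the Jacquet–Shalika hypothesis (iii).**  The hyperbolic pair
`z ⊕ z̄^{-1} = diag(archParamChar 1 1, archParamChar (-1) 1)` has `z`-exponents `1, 0` — distinct and in one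
coset — and `|Re t_i| = 1`, yet it is conjugate self-dual of BOTH parities; so "`< 1`" in (iii) cannot
be weakened to "`≤ 1`", and the parity alone does not pin the exponents of a non-tempered parameter.
[cite: Mok2014, Remark 2.2.2] -/
theorem isConjSelfDualOfParity_hyperbolicPair_example (η : ℤˣ) :
    IsConjSelfDualOfParity (diagParam ![archParamChar 1 1, archParamChar (-1) 1]) η := by
  rw [← conjDualChar_archParamChar]
  exact isConjSelfDualOfParity_diagParam_pair _ η

/-- **Multiset form in the `ArchWeight` currency of infinity types**: if `X` (multiplicity free, in one
real coset) is the multiset of `z`-exponents `a_i` of archimedean weights `w_i = (a_i, b_i)` whose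
parameter `diag(z^{a_i} z̄^{b_i})` is conjugate self-dual of parity `(-1)^{N-1} κ` and which satisfy the
Jacquet–Shalika bound `|Re(a_i + b_i)| < 1`, then `X ⊆ (N-1)/2 + (1-κ)/4 + ℤ`.
[cite: Mok2014, Cor. 2.5.5] [cite: RudnickSarnakDuke1996, (2.5) and Appendix A.3] -/
theorem forall_mem_exists_eq_add_coset_of_archWeights {N : ℕ} {κ : ℤˣ} {X : Multiset ℂ} {r : ℝ}
    (hnodup : X.Nodup) (hcoset : ∀ a ∈ X, ∃ m : ℤ, a = (m : ℂ) + (r : ℂ)) {w : Fin N → ArchWeight}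
    (hX : X = Finset.univ.val.map fun i => (w i).a) (hJS : ∀ i, |((w i).a + (w i).b).re| < 1)
    (h : IsConjSelfDualOfParity (diagParam fun i => (w i).char) ((-1) ^ (N + 1) * κ)) :
    ∀ a ∈ X, ∃ k : ℤ, a = (k : ℂ) + ((N : ℂ) - 1) / 2 + (1 - ((κ : ℤ) : ℂ)) / 4 := by
  have e : (fun i => (w i).a) =
      fun i => ((w i).a + (w i).b + ((w i).exists_int_sub.choose : ℂ)) / 2 :=
    funext fun i => ((w i).zExponent_char).symm
  rw [e] at hX
  exact forall_mem_exists_eq_add_coset_of_archParameter hnodup hcoset hX hJS h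

end Main

/-! ## §3b The local half of Mok's proof of Cor. 2.5.5 at the archimedean place, general exponents -/

section LHom

open WeilGroupReal

/-- **Thm. 2.4.10's conclusion at `v | ∞` ⇒ the tempered shape and the coset, for a general
archimedean parameter.**  Let `φ : W_ℝ → ᴸU(N)` be an `L`-homomorphism (what Mok's Thm. 2.4.10
provides for the localization of a conjugate self-dual cuspidal `Π` of sign `κ` at a real place of `F`
inert in `E`: "`φ^N_v` factors through `ξ_{χ_κ}`") and `χ_κ ∈ 𝒵_ℂ^κ`; suppose the parameter
`φ|_{W_ℂ} ⊗ χ_κ` (`= φ^N_v`) is `GL_N(ℂ)`-conjugate to `diag(archParamChar t_i m_i) = ⊕ z^{a_i} z̄^{b_i}`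
with `z`-exponents `a_i` pairwise distinct and in one coset of `ℤ`, and `|Re(a_i + b_i)| < 1`.  Then
every `t_i = a_i + b_i = 0` and every `a_i = m_i/2 ∈ (N-1)/2 + (1-κ)/4 + ℤ`: Lemma 2.2.1
(`IsLHom.isConjSelfDualOfParityGL_twistParam`, proved in `ConjSelfDualParityLEmbedding`) gives the
parity `(-1)^{N-1} κ`, which passes to the conjugate and to the matrix form
(`isConjSelfDualOfParityGL_archParamGL_iff`), and the main local lemma concludes.  This extends
`exists_half_eq_of_isLHom_of_eq_conj_unitaryDiagParam` (tempered shape assumed) to general exponents.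
[cite: Mok2014, Thm. 2.4.10, Lemma 2.2.1, Remark 2.2.2 and Cor. 2.5.5]
[cite: RudnickSarnakDuke1996, (2.5) and Appendix A.3] -/
theorem eq_zero_and_exists_half_eq_of_isLHom_of_eq_conj_archDiagParam {N : ℕ}
    {φ : WeilGroupReal →* LGroupU ℂ N sign} (hφ : IsLHom φ) {χ : sign.ker →* ℂˣ} {κ : ℤˣ}
    (hχ : IsConjSelfDualCharOfSign sign j sign_j χ κ) {t : Fin N → ℂ} {m : Fin N → ℤ}
    (hinj : Function.Injective fun i => (t i + (m i : ℂ)) / 2)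
    (hcoset : ∀ i j, ∃ k : ℤ, (t i + (m i : ℂ)) / 2 - (t j + (m j : ℂ)) / 2 = (k : ℂ))
    (hJS : ∀ i, |(t i).re| < 1) (g : GL (Fin N) ℂ)
    (hg : ∀ σ, twistParam hφ.restrict χ σ =
      g * archParamGL (diagParam fun i => archParamChar (t i) (m i)) σ * g⁻¹) (i : Fin N) :
    t i = 0 ∧ ∃ k : ℤ, (m i : ℂ) / 2 = (k : ℂ) + ((N : ℂ) - 1) / 2 + (1 - ((κ : ℤ) : ℂ)) / 4 :=
  exists_half_eq_of_isConjSelfDualOfParity_archDiagParam hinj hcoset hJS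
    ((isConjSelfDualOfParityGL_archParamGL_iff _ _).mp
      ((hφ.isConjSelfDualOfParityGL_twistParam sign_j hχ).of_eq_conj g hg)) i

end LHom

/-! ## §4 The named facts from the parameter-level archimedean statement -/

section Automorphic

open NumberField IsDedekindDomain

/-- **`Mok2014_archimedean_parity_of_asaiSignCont` from the parameter-level archimedean statement.**
The hypothesis `hparam` displays, in the tree's vocabulary and for `N ≥ 2` (rank one being the theorem
`Mok2014_archimedean_parity_of_asaiSignCont_rank_one`), what Mok's proof of Cor. 2.5.5 extracts at a
real place `v` of `F` under a `c`-fixed complex place `σ` of `E` from a conjugate self-dual cuspidal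
`Π` of Asai sign `κ` (continued currency `HasAsaiSignCont`): by Thm. 2.5.4 (a) `κ` is the sign of
Thm. 2.4.2, by Thm. 2.4.10 the localization `φ^N_v` factors through `ξ_{χ_κ}`, hence (Lemma 2.2.1) is
conjugate self-dual of parity `(-1)^{N-1} κ`; by the local Langlands correspondence for `GL_N(ℂ)`,
`φ^N_v|_{W_ℂ} = ⊕_i z^{a_i} z̄^{b_i} = diag(archParamChar t_i m_i)` with `{a_i} = {(t_i + m_i)/2}` the
archimedean parameter `χ σ` of `Π` (compatibility with infinitesimal characters); and
`|Re(a_i + b_i)| = |Re t_i| < 1` by Jacquet–Shalika.  Granted this, the fact follows from the main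
local lemma (`forall_mem_exists_eq_add_coset_of_archParameter`).  The hypothesis is a published
theorem (conditional, like all of Mok's results, on the stabilisation of the twisted trace formula)
but is not stated as a named fact of the tree: automorphic data carry no pairing-level archimedean
parameter yet.
[cite: Mok2014, Thm. 2.4.2, Thm. 2.4.10, Thm. 2.5.4 (a), Lemma 2.2.1, Remark 2.2.2 and Cor. 2.5.5]
[cite: RudnickSarnakDuke1996, (2.5) and Appendix A.3] -/
theorem Mok2014_archimedean_parity_of_asaiSignCont_of_archParameter
    (hparam : ∀ (F E : Type) [Field F] [NumberField F] [Field E] [NumberField E] [Algebra F E]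
      (c : E ≃ₐ[F] E), Module.finrank F E = 2 → c ≠ 1 →
      ∀ (N : ℕ) (hcpt : isCompact_glFiniteIntegralLevel N E) (P : CuspidalAutomorphicRepData N E hcpt)
        (κ : ℤˣ) (χ : (E →+* ℂ) → Multiset ℂ) (σ : E →+* ℂ),
        2 ≤ N → P.1.IsConjSelfDualAE c → P.1.HasAsaiSignCont c κ → P.1.HasArchParameter χ →
        NumberField.ComplexEmbedding.IsConj σ c →
        ∃ (t : Fin N → ℂ) (m : Fin N → ℤ),
          χ σ = Finset.univ.val.map (fun i => (t i + (m i : ℂ)) / 2) ∧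
          (∀ i, |(t i).re| < 1) ∧
          IsConjSelfDualOfParity (diagParam fun i => archParamChar (t i) (m i)) ((-1) ^ (N + 1) * κ)) :
    Mok2014_archimedean_parity_of_asaiSignCont := by
  refine Mok2014_archimedean_parity_of_asaiSignCont_of_two_le ?_
  intro F E _ _ _ _ _ c h2 hc N hcpt P κ χ σ r hN hcsd hsign hχ hσ hnodup hcoset
  obtain ⟨t, m, hX, hJS, hpar⟩ := hparam F E c h2 hc N hcpt P κ χ σ hN hcsd hsign hχ hσ
  exact forall_mem_exists_eq_add_coset_of_archParameter hnodup hcoset hX hJS hpar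

/-- **`Mok2014_archimedean_parity_of_asaiSign` (raw currency) from the parameter-level archimedean
statement and Mok's continued-pole dichotomy** (`Mok2014_partialAsaiL_continuation_pole_dichotomy`,
which turns the raw Asai sign into the continued one, `Mok2014_archimedean_parity_of_asaiSign_of_facts`).
[cite: Mok2014, §2.5 and Thm. 2.5.4 (a); Thm. 2.4.10, Lemma 2.2.1, Remark 2.2.2 and Cor. 2.5.5]
[cite: GrbacShahidi2015, Thm. 4.3 (2)] -/
theorem Mok2014_archimedean_parity_of_asaiSign_of_archParameter
    (hMok : Mok2014_partialAsaiL_continuation_pole_dichotomy)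
    (hparam : ∀ (F E : Type) [Field F] [NumberField F] [Field E] [NumberField E] [Algebra F E]
      (c : E ≃ₐ[F] E), Module.finrank F E = 2 → c ≠ 1 →
      ∀ (N : ℕ) (hcpt : isCompact_glFiniteIntegralLevel N E) (P : CuspidalAutomorphicRepData N E hcpt)
        (κ : ℤˣ) (χ : (E →+* ℂ) → Multiset ℂ) (σ : E →+* ℂ),
        2 ≤ N → P.1.IsConjSelfDualAE c → P.1.HasAsaiSignCont c κ → P.1.HasArchParameter χ →
        NumberField.ComplexEmbedding.IsConj σ c →
        ∃ (t : Fin N → ℂ) (m : Fin N → ℤ),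
          χ σ = Finset.univ.val.map (fun i => (t i + (m i : ℂ)) / 2) ∧
          (∀ i, |(t i).re| < 1) ∧
          IsConjSelfDualOfParity (diagParam fun i => archParamChar (t i) (m i)) ((-1) ^ (N + 1) * κ)) :
    Mok2014_archimedean_parity_of_asaiSign :=
  Mok2014_archimedean_parity_of_asaiSign_of_facts hMok
    (Mok2014_archimedean_parity_of_asaiSignCont_of_archParameter hparam)

open WeilGroupReal in
/-- **`Mok2014_archimedean_parity_of_asaiSignCont` from Thm. 2.4.10 in `L`-homomorphism form.**  The
hypothesis `hlhom` is the closest rendering of the missing global input in the tree's vocabulary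
(`ConjSelfDualParityLEmbedding`: `ᴸU(N) = GL_N(ℂ) ⋊ W_ℝ`, `IsLHom`, `𝒵_ℂ^κ`, `twistParam`): for `Π`
cuspidal, conjugate self-dual, of continued Asai sign `κ`, `N ≥ 2`, and a `c`-fixed complex place
`σ`, THERE IS an `L`-homomorphism `φ : W_ℝ → ᴸU(N)` and `χ_κ ∈ 𝒵_ℂ^κ` (Thm. 2.4.10 with Thm. 2.5.4 (a):
"`φ^N_v` factors through `ξ_{χ_κ}`") such that `φ|_{W_ℂ} ⊗ χ_κ = φ^N_v` is `GL_N(ℂ)`-conjugate to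
`⊕_i z^{a_i} z̄^{b_i}` with `{a_i} = χ σ` the archimedean parameter of `Π` (local Langlands for
`GL_N(ℂ)`, compatible with infinitesimal characters) and `|Re(a_i + b_i)| < 1` (Jacquet–Shalika).
Lemma 2.2.1 (proved) and the main local lemma do the rest.
[cite: Mok2014, Thm. 2.4.2, Thm. 2.4.10, Thm. 2.5.4 (a), Lemma 2.2.1, Remark 2.2.2 and Cor. 2.5.5]
[cite: RudnickSarnakDuke1996, (2.5) and Appendix A.3] -/
theorem Mok2014_archimedean_parity_of_asaiSignCont_of_archLHom
    (hlhom : ∀ (F E : Type) [Field F] [NumberField F] [Field E] [NumberField E] [Algebra F E]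
      (c : E ≃ₐ[F] E), Module.finrank F E = 2 → c ≠ 1 →
      ∀ (N : ℕ) (hcpt : isCompact_glFiniteIntegralLevel N E) (P : CuspidalAutomorphicRepData N E hcpt)
        (κ : ℤˣ) (χ : (E →+* ℂ) → Multiset ℂ) (σ : E →+* ℂ),
        2 ≤ N → P.1.IsConjSelfDualAE c → P.1.HasAsaiSignCont c κ → P.1.HasArchParameter χ →
        NumberField.ComplexEmbedding.IsConj σ c →
        ∃ (φ : WeilGroupReal →* LGroupU ℂ N sign) (hφ : IsLHom φ) (χκ : sign.ker →* ℂˣ)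
          (_ : IsConjSelfDualCharOfSign sign j sign_j χκ κ) (t : Fin N → ℂ) (m : Fin N → ℤ)
          (g : GL (Fin N) ℂ),
          χ σ = Finset.univ.val.map (fun i => (t i + (m i : ℂ)) / 2) ∧
          (∀ i, |(t i).re| < 1) ∧
          ∀ w, twistParam hφ.restrict χκ w =
            g * archParamGL (diagParam fun i => archParamChar (t i) (m i)) w * g⁻¹) :
    Mok2014_archimedean_parity_of_asaiSignCont := by
  refine Mok2014_archimedean_parity_of_asaiSignCont_of_archParameter ?_
  intro F E _ _ _ _ _ c h2 hc N hcpt P κ χ σ hN hcsd hsign hχ hσ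
  obtain ⟨φ, hφ, χκ, hχκ, t, m, g, hX, hJS, hg⟩ := hlhom F E c h2 hc N hcpt P κ χ σ hN hcsd hsign hχ hσ
  exact ⟨t, m, hX, hJS, (isConjSelfDualOfParityGL_archParamGL_iff _ _).mp
    ((hφ.isConjSelfDualOfParityGL_twistParam sign_j hχκ).of_eq_conj g hg)⟩

open WeilGroupReal in
/-- **`Mok2014_archimedean_parity_of_asaiSign` (raw currency) from Thm. 2.4.10 in `L`-homomorphism
form and Mok's continued-pole dichotomy.**
[cite: Mok2014, §2.5 and Thm. 2.5.4 (a); Thm. 2.4.10, Lemma 2.2.1, Remark 2.2.2 and Cor. 2.5.5]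
[cite: GrbacShahidi2015, Thm. 4.3 (2)] -/
theorem Mok2014_archimedean_parity_of_asaiSign_of_archLHom
    (hMok : Mok2014_partialAsaiL_continuation_pole_dichotomy)
    (hlhom : ∀ (F E : Type) [Field F] [NumberField F] [Field E] [NumberField E] [Algebra F E]
      (c : E ≃ₐ[F] E), Module.finrank F E = 2 → c ≠ 1 →
      ∀ (N : ℕ) (hcpt : isCompact_glFiniteIntegralLevel N E) (P : CuspidalAutomorphicRepData N E hcpt)
        (κ : ℤˣ) (χ : (E →+* ℂ) → Multiset ℂ) (σ : E →+* ℂ),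
        2 ≤ N → P.1.IsConjSelfDualAE c → P.1.HasAsaiSignCont c κ → P.1.HasArchParameter χ →
        NumberField.ComplexEmbedding.IsConj σ c →
        ∃ (φ : WeilGroupReal →* LGroupU ℂ N sign) (hφ : IsLHom φ) (χκ : sign.ker →* ℂˣ)
          (_ : IsConjSelfDualCharOfSign sign j sign_j χκ κ) (t : Fin N → ℂ) (m : Fin N → ℤ)
          (g : GL (Fin N) ℂ),
          χ σ = Finset.univ.val.map (fun i => (t i + (m i : ℂ)) / 2) ∧
          (∀ i, |(t i).re| < 1) ∧
          ∀ w, twistParam hφ.restrict χκ w =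
            g * archParamGL (diagParam fun i => archParamChar (t i) (m i)) w * g⁻¹) :
    Mok2014_archimedean_parity_of_asaiSign :=
  Mok2014_archimedean_parity_of_asaiSign_of_facts hMok
    (Mok2014_archimedean_parity_of_asaiSignCont_of_archLHom hlhom)

end Automorphic

end Literature.NumberTheory.Automorphic
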